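/-
Copyright (c) 2026. All rights reserved.
Released under Apache 2.0 license as described in the file LICENSE.
-/
import Literature.NumberTheory.PAdicHodge.LabelledWeightsRankOneThetaPeriodQl
import Literature.NumberTheory.PAdicHodge.UnramifiedCharacterUnitPeriods
import Literature.NumberTheory.PAdicHodge.LubinTateLogCoboundaries
import Literature.NumberTheory.PAdicHodge.EisensteinRootWittExists
import Literature.NumberTheory.GaloisRepresentations.HeckeCharacterLAdicDeRham
import Literature.NumberTheory.GaloisRepresentations.ArtinConductorLocalProofs
import Literature.NumberTheory.Automorphic.ReciprocityGLnQlModelProofs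
import HarnessLib

/-!
# Labelled Hodge–Tate weights of rank-one `ℓ`-adic characters of locally algebraic inertia shape

Let `F` be a `p`-adic field (`p = ℓ`), `ρ : Γ_F → ℚ̄_ℓˣ` a continuous character whose restriction to
the inertia subgroup of the Weil group has the shape
`ρ(w) = g(w) · ∏_{i ∈ s} emb_i(Art_F w)^{k_i}` with `g ≡ 1` on an open subgroup of units
(this is the local shape at `v ∣ ℓ` of Weil's `ℓ`-adic character of an algebraic Hecke character,
Serre 1968, Ch. III App. A).  Then for every continuous label `τ : F → ℚ̄_ℓ` the labelled Hodge–Tate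
weight of `ρ` at `τ` (Fontaine's `B_dR(F)`, tree convention `HT_τ(χ_cyc) = {-1}`) is

`HT_τ(ρ) = { -(∑_{i ∈ s, emb_i = τ} k_i) }`

(`labelledHodgeTateWeights_of_inertia_eq_mul_prod_emb`, and its form for THE pinned datum
`fontainePst F ℓ`, `fontainePst_labelledHodgeTateWeights_of_inertia_eq_mul_prod_emb`).

## Proof (Serre–Tate, by `ℂ_F`-periods)
By the one-period criterion `RankOneLabelledWeights.labelledHodgeTateWeights_eq_singleton_of_theta_period_of_hasQlModel`
it suffices to produce, for a finite model `r_{E'}` of `ρ` and `j : E' → F̄` with `j ∘ τ = incl`, ONE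
non-zero `y ∈ ℂ_F` with `y = j(det r_{E'}(σ)) · χ(σ)^n · σ(y)` on the pointwise stabiliser of a finite
`M/F`, `n = -k_τ`.  Write `det r_{E'} = μ · ν · ε` with `ε = ∏ emb_i(χ_π)^{k_i}` (`χ_π` the Lubin–Tate
character of a uniformiser), `μ` unramified and `ν` of finite inertial type
(`LocalKroneckerWeberLT.exists_unramified_mul_inertial`); the inertia shape and `χ_π = Art_F` on
inertia (Lubin–Tate) force `ν = 1` on an open subgroup, i.e. on the stabiliser of a finite extension.
Periods: `μ` has a unit period in `ℂ_F` (`UnramifiedCharacterPeriods.exists_unit_period_at_embedding`,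
Sen/Tate `H¹(Γ_F, ℂ_F(μ)) = 0` needs none: it is the unramified descent); for `γ : F → F̄` different
from the inclusion, `γ ∘ χ_π` has a unit period over a finite extension (the tree's
`lubinTateCharacterConjugateAdmissible_holds`, Serre–Tate: `γ ∘ χ_π` is Hodge–Tate of weight `0` at
the identity label); and the inclusion itself satisfies
`χ_π = χ_cyc · ω⁻¹ · ∏_{γ ≠ incl} (γ ∘ χ_π)⁻¹` in `ℂ_F` (norm formula `N_{F/ℚ_ℓ} ∘ χ_π = χ_cyc · ω⁻¹`
with `ω` unramified, `LubinTateLog.omegaChar_mul_norm`, and `N = ∏_γ γ`), so its period is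
`χ_cyc` times unit periods.  Multiplying the periods with the right exponents gives `y`.

## References
* [SerreAbelianLadic1968] J.-P. Serre, *Abelian ℓ-adic representations and elliptic curves*,
  Ch. III §1.1, App. A.4–A.5 (locally algebraic characters are Hodge–Tate with the expected weights).
* [Tate1967] J. Tate, *p-divisible groups*, §3.3 Thm. 2 and §4 Cor. 2.
* [FontaineAsterisque223III] J.-M. Fontaine, Astérisque 223, Exp. III §1.5, Prop. 1.5.2.
* [LubinTate1965] J. Lubin, J. Tate, *Formal complex multiplication in local fields*, Thm. 3.
-/

noncomputable section

open Field ValuativeRel Matrix WittVector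
open scoped MatrixGroups

namespace Literature.NumberTheory.PAdicHodge

open Literature.NumberTheory.GaloisRepresentations
open Literature.NumberTheory.GaloisRepresentations.IsNonarchimedeanLocalField
open Literature.NumberTheory.Automorphic

namespace RankOneLabelledWeights

/-! ### Small algebraic helpers -/

/-- An embedding `τ₀ : F → E` of `P`-algebras with `E/P` finite extends to a `P`-embedding
`j : E → L` into any algebraically closed `F`-algebra `L` with `j ∘ τ₀ = (F → L)` (view `E` as an
algebraic `F`-algebra through `τ₀` and take Mathlib's `IsAlgClosed.lift`).
[cite: Lang1965Algebra, Ch. VII §2, Thm. 2 (extension of embeddings into an algebraically closed field)] -/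
theorem exists_algHom_comp_eq_algebraMap {P F E L : Type*} [Field P] [Field F] [Field E] [Field L]
    [Algebra P F] [Algebra P E] [Algebra P L] [Algebra F L] [IsScalarTower P F L] [IsAlgClosed L]
    [FiniteDimensional P E] (τ₀ : F →ₐ[P] E) :
    ∃ j : E →ₐ[P] L, ∀ a, j (τ₀ a) = algebraMap F L a := by
  letI : Algebra F E := τ₀.toRingHom.toAlgebra
  haveI : IsScalarTower P F E := IsScalarTower.of_algebraMap_eq fun c => (τ₀.commutes c).symm
  haveI : Module.Finite F E := Module.Finite.of_restrictScalars_finite P F E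
  haveI : Algebra.IsAlgebraic F E := Algebra.IsAlgebraic.of_finite F E
  exact ⟨(IsAlgClosed.lift (R := F) (M := L) (S := E)).restrictScalars P,
    fun a => (IsAlgClosed.lift (R := F) (M := L) (S := E)).commutes a⟩

/-- `∏_{i ∈ s} a^{k i} = a^{∑_{i ∈ s} k i}` (integer exponents, `a ≠ 0` not needed in a group with
zero when read right-to-left as a definition of the empty product). [folklore] -/
private theorem prod_zpow_eq_zpow_sum {α ι : Type*} [Field α] (a : α) (ha : a ≠ 0) (k : ι → ℤ)
    (s : Finset ι) : ∏ i ∈ s, a ^ k i = a ^ ∑ i ∈ s, k i := by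
  classical
  induction s using Finset.induction_on with
  | empty => simp
  | insert i s hi ih => rw [Finset.prod_insert hi, Finset.sum_insert hi, ih, zpow_add₀ ha]

section PeriodCalculus

variable {G R : Type*} [Group G] [Field R] [MulSemiringAction G R]

/-- Periods multiply: multipliers multiply. [folklore] -/
private theorem per_mul {y₁ y₂ a₁ a₂ : R} {σ : G} (h₁ : y₁ = a₁ * σ • y₁) (h₂ : y₂ = a₂ * σ • y₂) :
    y₁ * y₂ = a₁ * a₂ * σ • (y₁ * y₂) := by
  rw [smul_mul']
  calc y₁ * y₂ = (a₁ * σ • y₁) * (a₂ * σ • y₂) := by rw [← h₁, ← h₂]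
    _ = a₁ * a₂ * (σ • y₁ * σ • y₂) := by ring

/-- A ring automorphism commutes with integer powers. [folklore] -/
private theorem smul_zpow' (σ : G) (z : R) (m : ℤ) : σ • z ^ m = (σ • z) ^ m :=
  map_zpow₀ (MulSemiringAction.toRingHom G R σ) z m

/-- `y = a·σ(y)` gives `y^{-m} = a^{-m}·σ(y^{-m})`. [folklore] -/
private theorem per_zpow_neg {z a : R} {σ : G} (h : z = a * σ • z) (m : ℤ) :
    z ^ (-m) = (a ^ m)⁻¹ * σ • z ^ (-m) := by
  rw [smul_zpow']
  conv_lhs => rw [h]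
  rw [mul_zpow, zpow_neg a m]

/-- `σ(u) = b·u` gives `u^m = b^{-m}·σ(u^m)`. [folklore] -/
private theorem per_of_smul {z b : R} {σ : G} (hb : b ≠ 0) (h : σ • z = b * z) (m : ℤ) :
    z ^ m = (b ^ m)⁻¹ * σ • z ^ m := by
  rw [smul_zpow', h, mul_zpow, ← mul_assoc, inv_mul_cancel₀ (zpow_ne_zero m hb), one_mul]

/-- `σ(u) = b·u` gives `u^{-m} = b^{m}·σ(u^{-m})`. [folklore] -/
private theorem per_of_smul_neg {z b : R} {σ : G} (hb : b ≠ 0) (h : σ • z = b * z) (m : ℤ) :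
    z ^ (-m) = b ^ m * σ • z ^ (-m) := by
  rw [smul_zpow', h, mul_zpow, zpow_neg b m, ← mul_assoc, mul_inv_cancel₀ (zpow_ne_zero m hb), one_mul]

/-- Finite products of periods. [folklore] -/
private theorem per_prod {ι : Type*} (t : Finset ι) {z a : ι → R} {σ : G}
    (h : ∀ i ∈ t, z i = a i * σ • z i) : ∏ i ∈ t, z i = (∏ i ∈ t, a i) * σ • ∏ i ∈ t, z i := by
  classical
  induction t using Finset.induction_on with
  | empty => simp
  | insert i t hi ih =>
    rw [Finset.prod_insert hi, Finset.prod_insert hi]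
    exact per_mul (h i (Finset.mem_insert_self i t)) (ih fun i' hi' => h i' (Finset.mem_insert_of_mem hi'))

/-- `a (b c d e) b⁻¹ = a c d e` for `b ≠ 0`. [folklore] -/
private theorem cancel_aux (a b c d e : R) (hb : b ≠ 0) : a * (b * c * d * e) * b⁻¹ = a * c * d * e := by
  rw [show a * (b * c * d * e) * b⁻¹ = a * c * d * e * (b * b⁻¹) by ring, mul_inv_cancel₀ hb, mul_one]

end PeriodCalculus

section BdR

variable {F : Type} [Field F] [ValuativeRel F] [TopologicalSpace F] [IsNonarchimedeanLocalField F]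
  [CharZero F] {ℓ : ℕ} [Fact ℓ.Prime] [Fact (¬ IsUnit (ℓ : integerC F))]
  [IsAdicComplete (Ideal.span {(ℓ : integerC F)}) (integerC F)]

-- Mathlib's own global value of `maxSynthPendingDepth` (see `PeriodRingData.rank_D_le`).
set_option maxSynthPendingDepth 3

set_option synthInstance.maxHeartbeats 200000 in
set_option maxHeartbeats 1600000 in
/-- **Labelled Hodge–Tate weights of a rank-one character of locally algebraic inertia shape**
(`B_dR(F)` form, for any — i.e. the unique — `ℚ_ℓ`-algebra structure on `F`).  If
`ρ : Γ_F → ℚ̄_ℓˣ` is de Rham and `ρ(w)₀₀ = g(w) · ∏_{i ∈ s} emb_i(Art_F w)^{k_i}` on the inertia of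
`W_F`, with `g(w) = 1` whenever `Art_F w` lies in the open subgroup `V`, then for every continuous
`τ : F → ℚ̄_ℓ`, `HT_τ(ρ) = {-(∑_{i ∈ s, emb_i = τ} k_i)}`.
[cite: SerreAbelianLadic1968, Ch. III §1.1 and App. A.4–A.5] [cite: Tate1967, §3.3 Thm. 2]
[cite: FontaineAsterisque223III, Exp. III §1.5 Prop. 1.5.2] -/
theorem labelledHodgeTateWeights_of_inertia_eq_mul_prod_emb [Algebra ℚ_[ℓ] F] (hF : valuation F ℓ < 1)
    {π : 𝒪[F]} (hπ : (valuation F).IsUniformizer (π : F))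
    {ι' : Type*} (s : Finset ι') (emb : ι' → (F →+* PadicAlgCl ℓ)) (hemb : ∀ i, Continuous (emb i))
    (k : ι' → ℤ) (ρ : FramedRep (absoluteGaloisGroup F) (PadicAlgCl ℓ) 1)
    (hρdR : ρ.IsDeRhamWith ‹Algebra ℚ_[ℓ] F› (bdRPeriodRingData (F := F) (p := ℓ) hF))
    (g : WeilGroup F → PadicAlgCl ℓ) (V : Subgroup Fˣ) (hV : IsOpen (V : Set Fˣ))
    (hg : ∀ w ∈ WeilGroup.inertia F, canonicalArtin F w ∈ V → g w = 1)
    (hρ : ∀ w ∈ WeilGroup.inertia F,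
      ((ρ (WeilGroup.toAbsGalois F w) : GL (Fin 1) (PadicAlgCl ℓ)) : Matrix (Fin 1) (Fin 1) (PadicAlgCl ℓ)) 0 0 =
        g w * ∏ i ∈ s, emb i ((canonicalArtin F w : Fˣ) : F) ^ k i)
    (τ : F →+* PadicAlgCl ℓ) (hτ : Continuous τ) [DecidablePred fun i => emb i = τ] :
    (bdRPeriodRingData (F := F) (p := ℓ) hF).labelledHodgeTateWeights (FramedRep.toContinuousRep ρ) τ =
      {-(∑ i ∈ s with emb i = τ, k i)} := by
  classical
  -- there is only one `ℚ_ℓ`-algebra structure on `F`: reduce to the canonical one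
  have halg : ∀ c, algebraMap ℚ_[ℓ] F c = LocalField.padicRingHom F ℓ hF c := algebraMap_padic_eq_padicRingHom hF
  obtain rfl : ‹Algebra ℚ_[ℓ] F› = LocalField.padicAlgebra F ℓ hF :=
    Algebra.algebra_ext _ _ fun c => by rw [halg]; rfl
  letI : Algebra ℚ_[ℓ] F := LocalField.padicAlgebra F ℓ hF
  haveI : FiniteDimensional ℚ_[ℓ] F := finiteDimensional_padicAlgebra hF
  haveI : Algebra.IsSeparable ℚ_[ℓ] F := Algebra.IsSeparable.of_integral ℚ_[ℓ] F
  -- continuous ring maps `F → ℚ̄_ℓ` are `ℚ_ℓ`-linear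
  have hcomm : ∀ e : F →+* PadicAlgCl ℓ, Continuous e → ∀ c : ℚ_[ℓ],
      e (algebraMap ℚ_[ℓ] F c) = algebraMap ℚ_[ℓ] (PadicAlgCl ℓ) c := by
    intro e he c
    have h := RingHom.padic_ext_of_continuous (e.comp (algebraMap ℚ_[ℓ] F)) (algebraMap ℚ_[ℓ] (PadicAlgCl ℓ))
      (he.comp (LocalField.continuous_padicRingHom F ℓ hF)) (continuous_algebraMap ℚ_[ℓ] (PadicAlgCl ℓ))
    exact RingHom.congr_fun h c
  let τa : F →ₐ[ℚ_[ℓ]] PadicAlgCl ℓ := ⟨τ, hcomm τ hτ⟩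
  let ea : ι' → (F →ₐ[ℚ_[ℓ]] PadicAlgCl ℓ) := fun i => ⟨emb i, hcomm (emb i) (hemb i)⟩
  -- §1. A finite model containing all the images of `F`.
  obtain ⟨E₀, rE₀, hfin₀, hmodel₀⟩ := exists_hasQlModel_holds ρ
  haveI := hfin₀
  obtain ⟨E', hfin', hle, hE'⟩ := exists_intermediateField_ge_forall_fieldRange_le (K := F) E₀
  haveI : FiniteDimensional ℚ_[ℓ] E' := hfin'
  have hcont : Continuous (IntermediateField.inclusion hle).toRingHom := continuous_inclusion hle
  let rE' : FramedRep (absoluteGaloisGroup F) E' 1 := rE₀.baseChange (IntermediateField.inclusion hle).toRingHom hcont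
  obtain ⟨Q, hQ⟩ := hmodel₀
  have hbc : rE'.baseChange (algebraMap E' (PadicAlgCl ℓ)) continuous_subtype_val =
      rE₀.baseChange (algebraMap E₀ (PadicAlgCl ℓ)) continuous_subtype_val :=
    ContinuousMonoidHom.ext fun g => Units.ext (Matrix.ext fun i j => rfl)
  have hmodel' : HasQlModel ρ E' rE' := ⟨Q, by rw [hbc, hQ]⟩
  have hρeq : ρ = (rE'.baseChange (algebraMap E' (PadicAlgCl ℓ)) continuous_subtype_val).conj Q := by
    rw [hbc, hQ]
  -- values: `ρ(σ)₀₀ = det r_{E'}(σ)`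
  have hval : ∀ σ, ((ρ σ : GL (Fin 1) (PadicAlgCl ℓ)) : Matrix (Fin 1) (Fin 1) (PadicAlgCl ℓ)) 0 0 =
      (((FramedRep.det rE' σ : (E')ˣ) : E') : PadicAlgCl ℓ) := by
    intro σ
    have h2 : Matrix.GeneralLinearGroup.det (ρ σ) =
        Matrix.GeneralLinearGroup.det ((rE'.baseChange (algebraMap E' (PadicAlgCl ℓ)) continuous_subtype_val) σ) := by
      rw [hρeq, FramedRep.conj_apply, map_mul, map_mul, map_inv, mul_inv_eq_iff_eq_mul, mul_comm]
    have h1 : ((ρ σ : GL (Fin 1) (PadicAlgCl ℓ)) : Matrix (Fin 1) (Fin 1) (PadicAlgCl ℓ)) 0 0 =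
        ((Matrix.GeneralLinearGroup.det (ρ σ) : (PadicAlgCl ℓ)ˣ) : PadicAlgCl ℓ) := by
      rw [Matrix.GeneralLinearGroup.val_det_apply, Matrix.det_fin_one]
    rw [h1, h2, Matrix.GeneralLinearGroup.val_det_apply, Matrix.det_fin_one, FramedRep.coe_baseChange_apply,
      Matrix.map_apply, FramedRep.det_apply, Matrix.GeneralLinearGroup.val_det_apply, Matrix.det_fin_one]
    rfl
  -- the labels through `E'`
  let τ₀ : F →ₐ[ℚ_[ℓ]] E' := (IntermediateField.inclusion (hE' τa)).comp τa.equivFieldRange.toAlgHom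
  have hτ₀ : ∀ a : F, ((τ₀ a : E') : PadicAlgCl ℓ) = τ a := fun _ => rfl
  let e₀ : ι' → (F →ₐ[ℚ_[ℓ]] E') := fun i => (IntermediateField.inclusion (hE' (ea i))).comp (ea i).equivFieldRange.toAlgHom
  have he₀ : ∀ i (a : F), ((e₀ i a : E') : PadicAlgCl ℓ) = emb i a := fun _ _ => rfl
  have he₀c : ∀ i, Continuous (e₀ i) := fun i => continuous_induced_rng.2 (hemb i)
  -- `j : E' → F̄` with `j ∘ τ₀ = incl`
  obtain ⟨j, hj⟩ := exists_algHom_comp_eq_algebraMap (L := AlgebraicClosure F) τ₀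
  -- which `emb i` give the inclusion after `j`
  let γ₁ : F →ₐ[ℚ_[ℓ]] AlgebraicClosure F := IsScalarTower.toAlgHom ℚ_[ℓ] F (AlgebraicClosure F)
  have hγeq : ∀ i, emb i = τ → ∀ a, j (e₀ i a) = algebraMap F (AlgebraicClosure F) a := by
    intro i hi a
    have : e₀ i a = τ₀ a := Subtype.ext (by rw [he₀, hτ₀, hi])
    rw [this, hj]
  have hγne : ∀ i, emb i ≠ τ → j.comp (e₀ i) ≠ γ₁ := by
    intro i hi h
    apply hi
    refine RingHom.ext fun a => ?_
    have h1 : j (e₀ i a) = j (τ₀ a) := by rw [hj]; exact AlgHom.congr_fun h a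
    have h2 : e₀ i a = τ₀ a := j.toRingHom.injective h1
    rw [← he₀, ← hτ₀, h2]
  -- §2. `det r_{E'} = μ · ν · ε`
  let eU : ι' → (absoluteGaloisGroup F →ₜ* (E')ˣ) := fun i =>
    ContinuousMonoidHom.comp ⟨Units.map (e₀ i : F →* E'), Continuous.units_map _ (he₀c i)⟩ (ltUnitsChar hπ)
  have heU : ∀ i σ, ((eU i σ : (E')ˣ) : E') = e₀ i (((lubinTateChar hπ σ : 𝒪[F]ˣ) : 𝒪[F]) : F) := fun _ _ => rfl
  set εE : absoluteGaloisGroup F →ₜ* (E')ˣ := ∏ i ∈ s, eU i ^ k i with hεE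
  have hεval : ∀ σ, ((εE σ : (E')ˣ) : E') = ∏ i ∈ s, e₀ i (((lubinTateChar hπ σ : 𝒪[F]ˣ) : 𝒪[F]) : F) ^ k i := by
    intro σ
    rw [hεE, ContinuousMonoidHom.finset_prod_apply', Units.coe_prod]
    refine Finset.prod_congr rfl fun i _ => ?_
    rw [ContinuousMonoidHom.zpow_apply', Units.val_zpow_eq_zpow_val, heU]
  set ψE : absoluteGaloisGroup F →ₜ* (E')ˣ := FramedRep.det rE' * εE⁻¹ with hψE
  have hψval : ∀ σ, ψE σ = FramedRep.det rE' σ * (εE σ)⁻¹ := fun _ => rfl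
  obtain ⟨μ, ν, hψμν, hμc, hνc, hμI, -, hνval⟩ :=
    LocalKroneckerWeberLT.exists_unramified_mul_inertial hπ ψE.toMonoidHom ψE.continuous
  -- `ν = 1` on `U = χ_π⁻¹(V)`
  set U : Subgroup (absoluteGaloisGroup F) := V.comap (ltUnitsChar hπ).toMonoidHom with hU
  have hUopen : IsOpen (U : Set (absoluteGaloisGroup F)) := hV.preimage (ltUnitsChar hπ).continuous
  have hνU : ∀ σ ∈ U, ν σ = 1 := by
    intro σ hσU
    obtain ⟨σ', hσ'I, hχeq⟩ := LocalKroneckerWeberLT.exists_mem_absInertia_lubinTateChar_eq hπ (lubinTateChar hπ σ)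
    rw [hνval σ σ' hσ'I hχeq]
    change ψE σ' = 1
    -- `σ'` as an element of the Weil group
    set w : WeilGroup F := WeilGroup.mk σ' ⟨0, isFrobPow_zero_iff_mem_absInertia.mpr hσ'I⟩ with hw
    have hwσ : WeilGroup.toAbsGalois F w = σ' := WeilGroup.toAbsGalois_mk _ _
    have hwI : w ∈ WeilGroup.inertia F := by rw [WeilGroup.mem_inertia_iff, hwσ]; exact hσ'I
    have hlt : ltUnitsChar hπ σ' = ltUnitsChar hπ σ := Units.ext (by rw [coe_ltUnitsChar_apply, coe_ltUnitsChar_apply, hχeq])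
    have hart : ltUnitsChar hπ σ' = canonicalArtin F w := by rw [← hwσ]; exact ltUnitsChar_eq_canonicalArtin hπ hwI
    have hgw : g w = 1 := hg w hwI (by rw [← hart, hlt]; exact hσU)
    have h00 : (((FramedRep.det rE' σ' : (E')ˣ) : E') : PadicAlgCl ℓ) = ((εE σ' : (E')ˣ) : E') := by
      rw [← hval, ← hwσ, hρ w hwI, hgw, one_mul, hwσ, hεval]
      change _ = algebraMap E' (PadicAlgCl ℓ) _
      rw [map_prod]
      refine Finset.prod_congr rfl fun i _ => ?_
      rw [map_zpow₀, ← hart, coe_ltUnitsChar_apply]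
      rfl
    rw [hψval, mul_inv_eq_one]
    exact Units.ext (Subtype.ext h00)
  -- a finite Galois `E₂/F` whose stabiliser lies in `U`
  obtain ⟨E₂, hE₂fin, -, hE₂U⟩ := absoluteGaloisGroup.exists_isGalois_fixingSubgroup_le_of_isOpen F U hUopen
  haveI := hE₂fin
  let M₂ : IntermediateField F (NormedAlgClosure F) :=
    E₂.map (NormedAlgClosure.toAlgClosure (F := F)).symm.toAlgHom
  haveI : FiniteDimensional F M₂ :=
    LinearEquiv.finiteDimensional (IntermediateField.equivMap E₂ (NormedAlgClosure.toAlgClosure (F := F)).symm.toAlgHom).toLinearEquiv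
  have hM₂U : ∀ σ : absoluteGaloisGroup F, (∀ m ∈ M₂, σ • m = m) → σ ∈ U := by
    intro σ hσ
    refine hE₂U σ ((IntermediateField.mem_fixingSubgroup_iff _ _).2 fun x hx => ?_)
    exact hσ _ ((IntermediateField.mem_map E₂).2 ⟨x, hx, rfl⟩)
  -- §3. Periods.
  -- (a) the unramified part `μ`
  obtain ⟨yμ, hyμ0, hyμ⟩ := UnramifiedCharacterPeriods.exists_unit_period_at_embedding_intermediateField
    (⟨μ, hμc⟩ : absoluteGaloisGroup F →ₜ* (E')ˣ) hμI j
  -- (b) the unramified character `ω = χ_cyc / (N ∘ χ_π)`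
  let ωQ : absoluteGaloisGroup F →* ℚ_[ℓ]ˣ :=
    (Units.map (PadicInt.Coe.ringHom (p := ℓ) : ℤ_[ℓ] →* ℚ_[ℓ])).comp (LubinTateLog.omegaChar hF hπ).toMonoidHom
  have hωQc : Continuous ωQ :=
    (Continuous.units_map (PadicInt.Coe.ringHom (p := ℓ) : ℤ_[ℓ] →* ℚ_[ℓ]) continuous_subtype_val).comp
      (LubinTateLog.omegaChar hF hπ).continuous
  have hωQI : ∀ σ ∈ absInertia F, ωQ σ = 1 := by
    intro σ hσ
    change Units.map _ (LubinTateLog.omegaChar hF hπ σ) = 1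
    rw [LubinTateLog.omegaChar_eq_one_of_mem_absInertia hF hπ hσ, map_one]
  obtain ⟨yω, hyω0, hyω⟩ := UnramifiedCharacterPeriods.exists_unit_period_at_embedding (F := F) (E := ℚ_[ℓ])
    ωQ hωQc hωQI (Algebra.ofId ℚ_[ℓ] (AlgebraicClosure F))
  have hfixQ : ∀ σ : absoluteGaloisGroup F, ∀ x : ℚ_[ℓ],
      σ • (Algebra.ofId ℚ_[ℓ] (AlgebraicClosure F)) x = (Algebra.ofId ℚ_[ℓ] (AlgebraicClosure F)) x := by
    intro σ x
    change σ • algebraMap ℚ_[ℓ] (AlgebraicClosure F) x = algebraMap ℚ_[ℓ] (AlgebraicClosure F) x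
    rw [IsScalarTower.algebraMap_apply ℚ_[ℓ] F (AlgebraicClosure F), absoluteGaloisGroup.smul_def, AlgEquiv.commutes]
  -- (c) the conjugates `γ ∘ χ_π`, `γ ≠ incl`
  obtain ⟨M₀, hM₀, hmem⟩ := LubinTateLog.exists_finiteDimensional_forall_mem hF (F := F)
  haveI := hM₀
  have hH := lubinTateCharacterConjugateAdmissible_holds hF hπ M₀ hM₀ hmem
  have hHγ : ∀ γ : F →ₐ[ℚ_[ℓ]] AlgebraicClosure F, γ ≠ γ₁ → ∃ u : CompletedAlgClosure F, u ≠ 0 ∧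
      ∀ σ : absoluteGaloisGroup F, (∀ y ∈ M₀, σ • y = y) →
        σ • u = algClosureToC F (γ (((lubinTateChar hπ σ : 𝒪[F]ˣ) : 𝒪[F]) : F)) * u := by
    intro γ hγ
    obtain ⟨u, hu0, hu⟩ := hH (LubinTateLog.flatEmb hF γ) (LubinTateLog.flatEmb_ne hF γ hγ)
    exact ⟨u, hu0, fun σ hσ => by rw [hu σ hσ, LubinTateLog.flatEmb_apply, algClosureToC_apply]⟩
  let u : (F →ₐ[ℚ_[ℓ]] AlgebraicClosure F) → CompletedAlgClosure F := fun γ =>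
    if hγ : γ = γ₁ then 1 else Classical.choose (hHγ γ hγ)
  have hu0 : ∀ γ, u γ ≠ 0 := by
    intro γ
    by_cases hγ : γ = γ₁
    · simp only [u, dif_pos hγ]; exact one_ne_zero
    · simp only [u, dif_neg hγ]; exact (Classical.choose_spec (hHγ γ hγ)).1
  have hu : ∀ γ, γ ≠ γ₁ → ∀ σ : absoluteGaloisGroup F, (∀ y ∈ M₀, σ • y = y) →
      σ • u γ = algClosureToC F (γ (((lubinTateChar hπ σ : 𝒪[F]ˣ) : 𝒪[F]) : F)) * u γ := by
    intro γ hγ σ hσ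
    simp only [u, dif_neg hγ]
    exact (Classical.choose_spec (hHγ γ hγ)).2 σ hσ
  -- §4. The norm identity `χ_π = χ_cyc · ω⁻¹ · ∏_{γ ≠ incl} (γ ∘ χ_π)⁻¹` in `ℂ_F`.
  let br : ℚ_[ℓ] →+* CompletedAlgClosure F := (algebraMap F (CompletedAlgClosure F)).comp (LocalField.padicRingHom F ℓ hF)
  let χq : absoluteGaloisGroup F → ℚ_[ℓ] := fun σ => (((GaloisRep.cyclotomicCharacter F ℓ σ : ℤ_[ℓ]ˣ) : ℤ_[ℓ]) : ℚ_[ℓ])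
  let xF : absoluteGaloisGroup F → F := fun σ => (((lubinTateChar hπ σ : 𝒪[F]ˣ) : 𝒪[F]) : F)
  let Pσ : absoluteGaloisGroup F → CompletedAlgClosure F := fun σ =>
    ∏ γ ∈ (Finset.univ.erase γ₁), algClosureToC F (γ (xF σ))
  have hbr : ∀ q, br q = algClosureToC F (algebraMap ℚ_[ℓ] (AlgebraicClosure F) q) := by
    intro q
    rw [IsScalarTower.algebraMap_apply ℚ_[ℓ] F (AlgebraicClosure F), algClosureToC_algebraMap]
    rfl
  have hx0 : ∀ σ, xF σ ≠ 0 := by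
    intro σ
    simp only [xF, ne_eq, ZeroMemClass.coe_eq_zero]
    exact (lubinTateChar hπ σ).ne_zero
  have hχ0 : ∀ σ, br (χq σ) ≠ 0 := fun σ =>
    (map_ne_zero br).2 (fun h => (GaloisRep.cyclotomicCharacter F ℓ σ).ne_zero (PadicInt.coe_eq_zero.mp h))
  have hω0 : ∀ σ, br ((ωQ σ : ℚ_[ℓ]ˣ) : ℚ_[ℓ]) ≠ 0 := fun σ => (map_ne_zero br).2 (ωQ σ).ne_zero
  have hP0 : ∀ σ, Pσ σ ≠ 0 := fun σ =>
    Finset.prod_ne_zero_iff.2 fun γ _ => (map_ne_zero _).2 ((map_ne_zero γ).2 (hx0 σ))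
  have hX : ∀ σ, algebraMap F (CompletedAlgClosure F) (xF σ) * Pσ σ = br (χq σ) * (br ((ωQ σ : ℚ_[ℓ]ˣ) : ℚ_[ℓ]))⁻¹ := by
    intro σ
    -- `N(χ_π σ) = ∏_γ γ(χ_π σ)` in `F̄`
    have hN : algebraMap ℚ_[ℓ] (AlgebraicClosure F) (Algebra.norm ℚ_[ℓ] (xF σ)) =
        ∏ γ : F →ₐ[ℚ_[ℓ]] AlgebraicClosure F, γ (xF σ) :=
      Algebra.norm_eq_prod_embeddings ℚ_[ℓ] (AlgebraicClosure F) (xF σ)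
    -- `χ = ω · N(χ_π)` in `ℚ_ℓ`
    have hχω : χq σ = ((ωQ σ : ℚ_[ℓ]ˣ) : ℚ_[ℓ]) * Algebra.norm ℚ_[ℓ] (xF σ) := by
      change (((GaloisRep.cyclotomicCharacter F ℓ σ : ℤ_[ℓ]ˣ) : ℤ_[ℓ]) : ℚ_[ℓ]) =
        (((LubinTateLog.omegaChar hF hπ σ : ℤ_[ℓ]ˣ) : ℤ_[ℓ]) : ℚ_[ℓ]) * Algebra.norm ℚ_[ℓ] (xF σ)
      rw [← LubinTateLog.coe_normLubinTateCharHom hF hπ σ, ← LubinTateLog.omegaChar_mul_norm hF hπ σ,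
        Units.val_mul, PadicInt.coe_mul]
    have h1 : algebraMap F (CompletedAlgClosure F) (xF σ) * Pσ σ =
        ∏ γ : F →ₐ[ℚ_[ℓ]] AlgebraicClosure F, algClosureToC F (γ (xF σ)) := by
      rw [← Finset.mul_prod_erase Finset.univ (fun γ : F →ₐ[ℚ_[ℓ]] AlgebraicClosure F => algClosureToC F (γ (xF σ)))
        (Finset.mem_univ γ₁)]
      exact congrArg₂ (· * ·) (algClosureToC_algebraMap (F := F) (xF σ)).symm rfl
    rw [h1, ← map_prod (algClosureToC F), ← hN, ← hbr, hχω, map_mul, mul_comm (br _) (br _),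
      mul_inv_cancel_right₀ (hω0 σ)]
  -- §5. The period.
  set kτ : ℤ := ∑ i ∈ s with emb i = τ, k i with hkτ
  let y : CompletedAlgClosure F :=
    yμ * yω ^ (-kτ) * (∏ γ ∈ Finset.univ.erase γ₁, u γ ^ kτ) * ∏ i ∈ s with ¬ emb i = τ, u (j.comp (e₀ i)) ^ (-(k i))
  have hy0 : y ≠ 0 := by
    refine mul_ne_zero (mul_ne_zero (mul_ne_zero hyμ0 (zpow_ne_zero _ hyω0)) ?_) ?_
    · exact Finset.prod_ne_zero_iff.2 fun γ _ => zpow_ne_zero _ (hu0 γ)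
    · exact Finset.prod_ne_zero_iff.2 fun i _ => zpow_ne_zero _ (hu0 _)
  -- the finite extension
  obtain ⟨M, hMfin, hM⟩ := exists_intermediateField_fixing_embedding (M₀ ⊔ M₂) j
  haveI := hMfin
  have hy : ∀ σ : absoluteGaloisGroup F, (∀ m ∈ M, σ • m = m) →
      y = algClosureToC F (j ((FramedRep.det rE' σ : (E')ˣ) : E')) * (br (χq σ)) ^ (-kτ) * σ • y := by
    intro σ hσ
    obtain ⟨hσ₁, hσj⟩ := hM σ hσ
    have hσ₀ : ∀ m ∈ M₀, σ • m = m := fun m hm => hσ₁ m (le_sup_left (a := M₀) (b := M₂) hm)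
    have hσ₂ : ∀ m ∈ M₂, σ • m = m := fun m hm => hσ₁ m (le_sup_right (a := M₀) (b := M₂) hm)
    have hν1 : ν σ = 1 := hνU σ (hM₂U σ hσ₂)
    -- the four factors
    have hA : yμ = algClosureToC F (j ((μ σ : (E')ˣ) : E')) * σ • yμ := hyμ σ hσj
    have hB : yω ^ (-kτ) = (br ((ωQ σ : ℚ_[ℓ]ˣ) : ℚ_[ℓ]) ^ kτ)⁻¹ * σ • yω ^ (-kτ) := by
      refine per_zpow_neg ?_ kτ
      rw [hbr]; exact hyω σ (hfixQ σ)
    have hC : (∏ γ ∈ Finset.univ.erase γ₁, u γ ^ kτ) =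
        (∏ γ ∈ Finset.univ.erase γ₁, (algClosureToC F (γ (xF σ)) ^ kτ)⁻¹) *
          σ • ∏ γ ∈ Finset.univ.erase γ₁, u γ ^ kτ :=
      per_prod _ fun γ hγ => per_of_smul ((map_ne_zero _).2 ((map_ne_zero γ).2 (hx0 σ)))
        (hu γ (Finset.ne_of_mem_erase hγ) σ hσ₀) kτ
    have hD : (∏ i ∈ s with ¬ emb i = τ, u (j.comp (e₀ i)) ^ (-(k i))) =
        (∏ i ∈ s with ¬ emb i = τ, algClosureToC F ((j.comp (e₀ i)) (xF σ)) ^ k i) *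
          σ • ∏ i ∈ s with ¬ emb i = τ, u (j.comp (e₀ i)) ^ (-(k i)) :=
      per_prod _ fun i hi => per_of_smul_neg ((map_ne_zero _).2 ((map_ne_zero (j.comp (e₀ i))).2 (hx0 σ)))
        (hu _ (hγne i (Finset.mem_filter.1 hi).2) σ hσ₀) (k i)
    have hyA := per_mul (per_mul (per_mul hA hB) hC) hD
    -- the multiplier `j(det r_{E'}(σ)) · χ(σ)^{-k_τ}`
    have hdet : FramedRep.det rE' σ = μ σ * εE σ := by
      have h := hψμν σ
      rw [hν1, mul_one] at h
      change ψE σ = μ σ at h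
      rw [hψval, mul_inv_eq_iff_eq_mul] at h
      exact h
    have hεC : algClosureToC F (j ((εE σ : (E')ˣ) : E')) = ∏ i ∈ s, algClosureToC F (j (e₀ i (xF σ))) ^ k i := by
      rw [hεval, map_prod, map_prod]
      exact Finset.prod_congr rfl fun i _ => by rw [map_zpow₀, map_zpow₀]
    have hs₁ : (∏ i ∈ s with emb i = τ, algClosureToC F (j (e₀ i (xF σ))) ^ k i) =
        algebraMap F (CompletedAlgClosure F) (xF σ) ^ kτ := by
      rw [hkτ, ← prod_zpow_eq_zpow_sum _ ((map_ne_zero _).2 (hx0 σ))]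
      refine Finset.prod_congr rfl fun i hi => ?_
      rw [hγeq i (Finset.mem_filter.1 hi).2, algClosureToC_algebraMap]
    have hXσ : algebraMap F (CompletedAlgClosure F) (xF σ) =
        br (χq σ) * (br ((ωQ σ : ℚ_[ℓ]ˣ) : ℚ_[ℓ]))⁻¹ * (Pσ σ)⁻¹ :=
      (eq_mul_inv_iff_mul_eq₀ (hP0 σ)).2 (hX σ)
    have hPk : (∏ γ ∈ Finset.univ.erase γ₁, (algClosureToC F (γ (xF σ)) ^ kτ)⁻¹) = ((Pσ σ) ^ kτ)⁻¹ := by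
      rw [Finset.prod_inv_distrib, Finset.prod_zpow]
    have hmult : algClosureToC F (j ((FramedRep.det rE' σ : (E')ˣ) : E')) * (br (χq σ)) ^ (-kτ) =
        algClosureToC F (j ((μ σ : (E')ˣ) : E')) * (br ((ωQ σ : ℚ_[ℓ]ˣ) : ℚ_[ℓ]) ^ kτ)⁻¹ *
          (∏ γ ∈ Finset.univ.erase γ₁, (algClosureToC F (γ (xF σ)) ^ kτ)⁻¹) *
          ∏ i ∈ s with ¬ emb i = τ, algClosureToC F ((j.comp (e₀ i)) (xF σ)) ^ k i := by
      rw [hdet, Units.val_mul, map_mul, map_mul, hεC,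
        ← Finset.prod_filter_mul_prod_filter_not s (fun i => emb i = τ), hs₁, hXσ, hPk, _root_.zpow_neg,
        mul_zpow, mul_zpow, _root_.inv_zpow, _root_.inv_zpow]
      exact cancel_aux _ _ _ _ _ (zpow_ne_zero _ (hχ0 σ))
    rw [hmult]
    exact hyA
  -- §6. Conclusion by the one-period criterion.
  have h := labelledHodgeTateWeights_eq_singleton_of_theta_period_of_hasQlModel hF hρdR hE' hmodel' τa τ₀ hτ₀ j hj M hy0 hy
  exact h

end BdR

section Pinned

variable {F : Type} [Field F] [ValuativeRel F] [TopologicalSpace F] [IsNonarchimedeanLocalField F]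
  [CharZero F] {ℓ : ℕ} [Fact ℓ.Prime]

set_option maxSynthPendingDepth 3 in
/-- **Labelled Hodge–Tate weights of a rank-one character of locally algebraic inertia shape, for
THE pinned datum `fontainePst F ℓ`.**  If `ρ : Γ_F → ℚ̄_ℓˣ` satisfies
`ρ(w)₀₀ = g(w) · ∏_{i ∈ s} emb_i(Art_F w)^{k_i}` on the inertia of `W_F` with `g(w) = 1` whenever
`Art_F w ∈ V` (`V ⊆ Fˣ` open), then `ρ` is de Rham (accepted
`fontainePst_isDeRhamFramed_of_inertia_eq_mul_prod_emb`) and for every continuous `τ : F → ℚ̄_ℓ`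
its labelled Hodge–Tate weight at `τ` is `-(∑_{i ∈ s, emb_i = τ} k_i)` — the local content of
"algebraic Hecke characters of infinity type `(p_e)` have `ℓ`-adic avatars with labelled weights
read off from `(p_e)`" (Serre; Weil's `χ_{ℓ,ι}`).
[cite: SerreAbelianLadic1968, Ch. III §1.1 and App. A.4–A.5] [cite: Tate1967, §3.3 Thm. 2]
[cite: FontaineAsterisque223III, Exp. III §1.5 Prop. 1.5.2] -/
theorem fontainePst_labelledHodgeTateWeights_of_inertia_eq_mul_prod_emb (hF : valuation F ℓ < 1)
    {π : 𝒪[F]} (hπ : (valuation F).IsUniformizer (π : F))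
    {ι' : Type*} (s : Finset ι') (emb : ι' → (F →+* PadicAlgCl ℓ)) (hemb : ∀ i, Continuous (emb i))
    (k : ι' → ℤ) (ρ : FramedRep (absoluteGaloisGroup F) (PadicAlgCl ℓ) 1)
    (g : WeilGroup F → PadicAlgCl ℓ) (V : Subgroup Fˣ) (hV : IsOpen (V : Set Fˣ))
    (hg : ∀ w ∈ WeilGroup.inertia F, canonicalArtin F w ∈ V → g w = 1)
    (hρ : ∀ w ∈ WeilGroup.inertia F,
      ((ρ (WeilGroup.toAbsGalois F w) : GL (Fin 1) (PadicAlgCl ℓ)) : Matrix (Fin 1) (Fin 1) (PadicAlgCl ℓ)) 0 0 =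
        g w * ∏ i ∈ s, emb i ((canonicalArtin F w : Fˣ) : F) ^ k i)
    (τ : F →+* PadicAlgCl ℓ) (hτ : Continuous τ) [DecidablePred fun i => emb i = τ] :
    letI := (fontainePst F ℓ hF).algebra
    (fontainePst F ℓ hF).𝔅.labelledHodgeTateWeights (FramedRep.toContinuousRep ρ) τ =
      {-(∑ i ∈ s with emb i = τ, k i)} := by
  haveI : Fact (¬ IsUnit (ℓ : integerC F)) := ⟨not_isUnit_natCast_integerC hF⟩
  haveI : IsAdicComplete (Ideal.span {(ℓ : integerC F)}) (integerC F) := isAdicComplete_integerC_natCast hF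
  have hdR := fontainePst_isDeRhamFramed_of_inertia_eq_mul_prod_emb hF hπ s emb hemb k ρ g V hV hg hρ
  letI := (fontainePst F ℓ hF).algebra
  have hdR' : ρ.IsDeRhamWith (fontainePst F ℓ hF).algebra (bdRPeriodRingData (F := F) (p := ℓ) hF) := by
    rw [← fontainePst_𝔅_eq_bdRPeriodRingData hF]; exact hdR
  rw [fontainePst_𝔅_eq_bdRPeriodRingData hF]
  exact labelledHodgeTateWeights_of_inertia_eq_mul_prod_emb hF hπ s emb hemb k ρ hdR' g V hV hg hρ τ hτ

end Pinned

end RankOneLabelledWeights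

end Literature.NumberTheory.PAdicHodge
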